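import Summits.NavierStokesRegularity.NavierStokesRegularity.Theorems.AdaptedFrequencyTangentFlowTransferZoomFrequency
import Summits.NavierStokesRegularity.NavierStokesRegularity.Theorems.AdaptedFrequencyTangentFlowTransferViscosity
import Literature.Analysis.FluidPDE.BoundedL2ClassicalMild
import Literature.Analysis.FluidPDE.KNSSTypeIRateMildProofs
import Literature.Analysis.FluidPDE.NSLerayHopfSereginProofs
import Literature.Analysis.FluidPDE.LerayHopf
import HarnessLib

/-!
# The normalised blow-up sequence of `TangentFlowTransfer`: set-up
# (route `AdaptedFrequency`, item `TangentFlowTransfer`, stmt-NavierStokesRegularity-10494)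

Helper file (all results proved). From the data of the item — a classical Leray–Hopf solution
`(u, p)` on `[0, T)` with Type-I rate, an adapted comparable kernel `G` on `[t₀, T)` with pole
`(T, x₀)` — we build the unit-viscosity, zoomed blow-up sequence about the pole and record every
property the compactness / stability / non-degeneracy steps consume:

* viscosity normalisation `u♭ = ν⁻¹ u(·/ν, ·)`, `G♭ = G(·/ν, ·)`, pole `(νT, x₀)`
  (`AdaptedFrequencyTangentFlowTransferViscosity`);
* Oseen-mildness of `u♭` below the blow-up time: Type-I bound on a window + the Leray–Hopf energy
  bound `‖u(t)‖₂ ≤ (2E₀)^{1/2}` (`eLpNorm_two_le_of_isLerayHopfOn`) feed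
  `mild_of_bounded_of_eLpNorm_two_le_of_lt` (`BoundedL2ClassicalMild`);
* the zoom `w k = c_k u♭(νT + c_k² ·, x₀ + c_k ·)`, `g k = c_k³ G♭(…)`, `c_k = 1/(k+2)`, on the
  windows `[A_k, 0)`, `A_k = (a − νT)/c_k² → −∞`: classical (`ν = 1`), Type-I with constant
  `C₀/√ν`, Oseen-mild between window times (`oseen_smul_stPull`), kernels adapted with the same
  Gaussian constants (`isAdaptedBackwardKernel_zoom_Ico`, `gaussian_bounds_zoom`), frequencies
  `Λ_k(τ) → Λ₀` (`tendsto_adaptedFrequency_zoom_seq`).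
-/

noncomputable section

open MeasureTheory Set Function Filter TopologicalSpace Metric
open scoped Topology NNReal ENNReal InnerProductSpace

namespace Summit.NavierStokesRegularity.NavierStokesRegularity.Theorems

open Literature.Analysis Literature.Analysis.FluidPDE

/-- `L²` norms under a pure time dilation (`γ = 1`, `x₀ = 0`):
`‖(α • stPull β 1 t₀ 0 u) s‖_{Lᵖ} = ‖α‖ₑ ‖u (t₀ + β s)‖_{Lᵖ}`. [folklore] -/
theorem eLpNorm_smul_stPull_one {E : Type*} [NormedAddCommGroup E] [InnerProductSpace ℝ E]
    [MeasureSpace E] (α β t₀ : ℝ) (u : ℝ → E → E) (s : ℝ) (p : ℝ≥0∞) :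
    eLpNorm ((α • stPull β 1 t₀ (0 : E) u) s) p volume = ‖α‖ₑ * eLpNorm (u (t₀ + β * s)) p volume := by
  have h1 : (α • stPull β 1 t₀ (0 : E) u) s = α • u (t₀ + β * s) := by
    funext y; simp [stPull_apply]
  rw [h1, eLpNorm_const_smul]

/-- **Oseen-mildness of the viscosity-normalised solution below the blow-up time.** Let `(u, p)`
be a classical solution of the unforced Navier–Stokes system (viscosity `ν > 0`) on `[0, T)`,
Leray–Hopf from `u 0`, with the Type-I bound `‖u(t)‖ ≤ C₀/√(T − t)` on `(t₁, T)`, `0 ≤ t₁`.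
Then `u♭ = ν⁻¹ • stPull ν⁻¹ 1 0 0 u` satisfies `u♭(t) = e^{(t−s)Δ}u♭(s) − B¹ₛ(u♭, u♭)(t)` for all
`νt₁ < s < t < νT` (bounded by Type I and uniformly `L²` by the energy inequality on every
`(νt₁, T′]`, `T′ < νT`; `mild_of_bounded_of_eLpNorm_two_le_of_lt`). [folklore] -/
theorem oseenMild_viscosity_of_typeI_window {ν T : ℝ} (hν : 0 < ν)
    {u : ℝ → EuclideanSpace ℝ (Fin 3) → EuclideanSpace ℝ (Fin 3)}
    {p : ℝ → EuclideanSpace ℝ (Fin 3) → ℝ} (hcl : IsClassicalNSSolutionOn (Ico 0 T) ν 0 u p)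
    (hLH : IsLerayHopfOn T ν 0 (u 0) u) {C₀ t₁ : ℝ} (ht₁0 : 0 ≤ t₁)
    (hI : ∀ t ∈ Ioo t₁ T, ∀ x, ‖u t x‖ ≤ C₀ / Real.sqrt (T - t)) {s t : ℝ} (hs : ν * t₁ < s)
    (hst : s < t) (htT : t < ν * T) (y : EuclideanSpace ℝ (Fin 3)) :
    (ν⁻¹ • stPull ν⁻¹ 1 0 0 u) t y =
      UnboundedOperators.heatExtension ((ν⁻¹ • stPull ν⁻¹ 1 0 0 u) s) (t - s) y -
        oseenDuhamel 1 s (ν⁻¹ • stPull ν⁻¹ 1 0 0 u) (ν⁻¹ • stPull ν⁻¹ 1 0 0 u) t y := by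
  set v := ν⁻¹ • stPull ν⁻¹ 1 0 (0 : EuclideanSpace ℝ (Fin 3)) u with hv
  set q := (ν⁻¹) ^ 2 • stPull ν⁻¹ 1 0 (0 : EuclideanSpace ℝ (Fin 3)) p with hq
  -- an intermediate blow-down time `T' ∈ (t, νT)`
  set T' : ℝ := (t + ν * T) / 2 with hT'
  have htT' : t < T' := by rw [hT']; linarith
  have hT'T : T' < ν * T := by rw [hT']; linarith
  -- `v` is classical with unit viscosity on `(νt₁, νT)`
  have hclv : IsClassicalNSSolutionOn (Ioo (ν * t₁) (ν * T)) 1 0 v q := by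
    have h := isClassicalNSSolutionOn_viscosity_Ico hν hcl
    rw [mul_zero] at h
    refine h.mono (fun r hr => ⟨?_, hr.2⟩) (uniqueDiffOn_Ioo _ _)
    have : 0 ≤ ν * t₁ := mul_nonneg hν.le ht₁0
    linarith [hr.1]
  -- the Type-I bound for `v` on `(νt₁, νT)` gives a bound on `(νt₁, T']`
  have hIv := typeI_bound_viscosity hI hν
  set L : ℝ := (C₀ / Real.sqrt ν) / Real.sqrt (ν * T - T') with hL
  have hLv : ∀ r ∈ Ioc (ν * t₁) T', ∀ x, ‖v r x‖ ≤ L := by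
    intro r hr x
    have hrT : r < ν * T := lt_of_le_of_lt hr.2 hT'T
    have hb := hIv r ⟨hr.1, hrT⟩ x
    refine hb.trans ?_
    have hC : 0 ≤ C₀ / Real.sqrt ν := by
      have h1 := (norm_nonneg _).trans hb
      have h2 : 0 < Real.sqrt (ν * T - r) := Real.sqrt_pos.2 (by linarith)
      by_contra hC; push Not at hC
      have : C₀ / Real.sqrt ν / Real.sqrt (ν * T - r) < 0 := div_neg_of_neg_of_pos hC h2
      linarith
    rw [hL]
    exact div_le_div_of_nonneg_left hC (Real.sqrt_pos.2 (by linarith))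
      (Real.sqrt_le_sqrt (by linarith [hr.2]))
  -- the uniform `L²` bound from the energy inequality
  have hE := fun r (hr : r ∈ Icc 0 T) => eLpNorm_two_le_of_isLerayHopfOn hν.le hLH hr
  set K : ℝ≥0∞ := ‖ν⁻¹‖ₑ * ENNReal.ofReal (2 * VectorCalculus.kineticEnergy (u 0)) ^ (2⁻¹ : ℝ)
    with hK
  have hKtop : K ≠ ∞ := ENNReal.mul_ne_top enorm_ne_top
    (ENNReal.rpow_ne_top_of_nonneg (by norm_num) ENNReal.ofReal_ne_top)
  have hKv : ∀ r ∈ Ioc (ν * t₁) T', eLpNorm (v r) 2 volume ≤ K := by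
    intro r hr
    rw [hv, eLpNorm_smul_stPull_one, hK]
    refine mul_le_mul_right (hE _ ⟨?_, ?_⟩) _
    · have : 0 ≤ ν * t₁ := mul_nonneg hν.le ht₁0
      have h1 : 0 ≤ r := by linarith [hr.1]
      simp only [zero_add]; positivity
    · have h2 : r ≤ ν * T := hr.2.trans hT'T.le
      simp only [zero_add]
      rw [inv_mul_le_iff₀ hν]; linarith
  exact mild_of_bounded_of_eLpNorm_two_le_of_lt hclv (by
      have : ν * t₁ < t := hs.trans hst
      linarith) hT'T hLv hKtop hKv hs hst htT' y

/-- The windows `A_k = (νa − νT)/c_k² → −∞` when `a < T`, `ν > 0` and `c_k → 0⁺`. [folklore] -/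
theorem tendsto_window_atBot {ν a T : ℝ} (hν : 0 < ν) (haT : a < T) {c : ℕ → ℝ}
    (hc : ∀ k, 0 < c k) (hc0 : Tendsto c atTop (𝓝 0)) :
    Tendsto (fun k => (ν * a - ν * T) / c k ^ 2) atTop atBot := by
  have h1 : Tendsto (fun k => c k ^ 2) atTop (𝓝[>] 0) := by
    refine tendsto_nhdsWithin_iff.2 ⟨?_, Eventually.of_forall fun k => pow_pos (hc k) 2⟩
    simpa using hc0.pow 2
  have h2 : Tendsto (fun k => (c k ^ 2)⁻¹) atTop atTop := tendsto_inv_nhdsGT_zero.comp h1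
  have hneg : ν * a - ν * T < 0 := by nlinarith
  have h3 := h2.const_mul_atTop_of_neg hneg
  refine h3.congr fun k => ?_
  rw [div_eq_mul_inv]

/-- **The zoomed, viscosity-normalised blow-up sequence and everything the transfer consumes.**
Data: a classical solution `(u, p)` of the unforced Navier–Stokes system (viscosity `ν > 0`) on
`[0, T)`, Leray–Hopf from `u 0`, with the Type-I bound `‖u‖ ≤ C/√(T − t)` on `(t₁, T)`; an
adapted kernel `G` of `u` on `[t₀, T)` with pole `(T, x₀)` and two-sided Gaussian bounds
(constants `c₁, c₂, C₁, C₂`); adapted frequency `Λ(t) → Λ₀` as `t ↑ T`; scales `c_k → 0⁺`.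
With `a = max (max t₁ 0) t₀`, `u♭ = ν⁻¹ u(·/ν, ·)`, windows `A_k = (νa − νT)/c_k²` and
`w_k = c_k u♭(νT + c_k² ·, x₀ + c_k ·)`, there are pressures and kernels `g_k` such that, for
every `k`: `(w_k, p_k)` is classical with unit viscosity on `[A_k, 0)`; `‖w_k(t)‖ ≤ C₀/√(−t)` on
`(A_k, 0)` with `C₀ = max C 0/√ν`; `w_k` is Oseen-mild between any two window times; `g_k` is an
adapted kernel of `w_k` on `[A_k, 0)` with pole `(0, 0)` and Gaussian bounds with the constants
`(c₁ν^{3/2}, c₂/ν, C₁ν^{3/2}, C₂/ν)` (the same for all `k`); and the adapted frequencies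
converge, `Λ_k(τ) → Λ₀` for every `τ < 0`. [folklore] -/
theorem exists_zoom_blowupData {ν T : ℝ} (hν : 0 < ν) (hT : 0 < T)
    {u : ℝ → EuclideanSpace ℝ (Fin 3) → EuclideanSpace ℝ (Fin 3)}
    {p : ℝ → EuclideanSpace ℝ (Fin 3) → ℝ} (hcl : IsClassicalNSSolutionOn (Ico 0 T) ν 0 u p)
    (hLH : IsLerayHopfOn T ν 0 (u 0) u) {C t₁ : ℝ} (ht₁T : t₁ < T)
    (hI : ∀ t ∈ Ioo t₁ T, ∀ x, ‖u t x‖ ≤ C / Real.sqrt (T - t))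
    {x₀ : EuclideanSpace ℝ (Fin 3)} {t₀ : ℝ} (ht₀ : t₀ ∈ Ico 0 T)
    {G : ℝ → EuclideanSpace ℝ (Fin 3) → ℝ} (hK : IsAdaptedBackwardKernel ν u (Ico t₀ T) T x₀ G)
    {c₁ c₂ C₁ C₂ : ℝ}
    (hGb : ∀ t ∈ Ico t₀ T, ∀ x,
      c₁ * (T - t) ^ (-(3:ℝ) / 2) * Real.exp (-(‖x - x₀‖ ^ 2) / (c₂ * (T - t))) ≤ G t x ∧
        G t x ≤ C₁ * (T - t) ^ (-(3:ℝ) / 2) * Real.exp (-(‖x - x₀‖ ^ 2) / (C₂ * (T - t))))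
    {Λ₀ : ℝ} (hlim : Tendsto (adaptedFrequency u G T) (𝓝[<] T) (𝓝 Λ₀))
    {c : ℕ → ℝ} (hc : ∀ k, 0 < c k) (hc0 : Tendsto c atTop (𝓝 0)) :
    ∃ (C₀ : ℝ) (A : ℕ → ℝ) (w : ℕ → ℝ → EuclideanSpace ℝ (Fin 3) → EuclideanSpace ℝ (Fin 3))
      (pw : ℕ → ℝ → EuclideanSpace ℝ (Fin 3) → ℝ) (g : ℕ → ℝ → EuclideanSpace ℝ (Fin 3) → ℝ),
      w = (fun k => c k • stPull (c k ^ 2) (c k) (ν * T) x₀ (ν⁻¹ • stPull ν⁻¹ 1 0 0 u)) ∧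
      0 ≤ C₀ ∧ Tendsto A atTop atBot ∧ (∀ k, A k < 0) ∧
      (∀ k, IsClassicalNSSolutionOn (Ico (A k) 0) 1 0 (w k) (pw k)) ∧
      (∀ k, ∀ t ∈ Ioo (A k) 0, ∀ x, ‖w k t x‖ ≤ C₀ / Real.sqrt (-t)) ∧
      (∀ k, ∀ s t : ℝ, A k < s → s < t → t < 0 → ∀ x,
        w k t x = UnboundedOperators.heatExtension (w k s) (t - s) x -
          oseenDuhamel 1 s (w k) (w k) t x) ∧
      (∀ k, IsAdaptedBackwardKernel 1 (w k) (Ico (A k) 0) 0 0 (g k)) ∧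
      (∀ k, ∀ t ∈ Ico (A k) 0, ∀ x,
        (c₁ * ν ^ ((3:ℝ) / 2)) * ((0:ℝ) - t) ^ (-(3:ℝ) / 2) *
            Real.exp (-(‖x - (0 : EuclideanSpace ℝ (Fin 3))‖ ^ 2) / ((c₂ / ν) * ((0:ℝ) - t))) ≤
          g k t x ∧
        g k t x ≤ (C₁ * ν ^ ((3:ℝ) / 2)) * ((0:ℝ) - t) ^ (-(3:ℝ) / 2) *
            Real.exp (-(‖x - (0 : EuclideanSpace ℝ (Fin 3))‖ ^ 2) / ((C₂ / ν) * ((0:ℝ) - t)))) ∧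
      (∀ τ < 0, Tendsto (fun k => adaptedFrequency (w k) (g k) 0 τ) atTop (𝓝 Λ₀)) := by
  -- the window below the blow-up time on which everything is available
  set a : ℝ := max (max t₁ 0) t₀ with ha
  have ha0 : 0 ≤ a := le_trans (le_max_right _ _) (le_max_left _ _)
  have ht₁a : t₁ ≤ a := le_trans (le_max_left _ _) (le_max_left _ _)
  have ht₀a : t₀ ≤ a := le_max_right _ _
  have haT : a < T := max_lt (max_lt ht₁T hT) ht₀.2
  -- Type-I bound with a nonnegative constant on `(a, T)`
  set Cp : ℝ := max C 0 with hCp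
  have hIp : ∀ t ∈ Ioo a T, ∀ x, ‖u t x‖ ≤ Cp / Real.sqrt (T - t) := by
    intro t ht x
    have h1 := hI t ⟨lt_of_le_of_lt ht₁a ht.1, ht.2⟩ x
    exact h1.trans (div_le_div_of_nonneg_right (le_max_left _ _) (Real.sqrt_nonneg _))
  -- viscosity normalisation
  set ub : ℝ → EuclideanSpace ℝ (Fin 3) → EuclideanSpace ℝ (Fin 3) :=
    ν⁻¹ • stPull ν⁻¹ 1 0 0 u with hub
  set pb : ℝ → EuclideanSpace ℝ (Fin 3) → ℝ := (ν⁻¹) ^ 2 • stPull ν⁻¹ 1 0 0 p with hpb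
  set Gb : ℝ → EuclideanSpace ℝ (Fin 3) → ℝ := stPull ν⁻¹ 1 0 0 G with hGb'
  have hclb : IsClassicalNSSolutionOn (Ico (ν * a) (ν * T)) 1 0 ub pb :=
    isClassicalNSSolutionOn_viscosity_Ico hν (hcl.mono (Ico_subset_Ico_left ha0) (uniqueDiffOn_Ico _ _))
  have hIb : ∀ s ∈ Ioo (ν * a) (ν * T), ∀ y, ‖ub s y‖ ≤ (Cp / Real.sqrt ν) / Real.sqrt (ν * T - s) :=
    typeI_bound_viscosity hIp hν
  have hKb : IsAdaptedBackwardKernel 1 ub (Ico (ν * a) (ν * T)) (ν * T) x₀ Gb :=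
    isAdaptedBackwardKernel_viscosity_Ico (hK.mono (Ico_subset_Ico_left ht₀a) (uniqueDiffOn_Ico _ _)) hν
  have hlimb : Tendsto (adaptedFrequency ub Gb (ν * T)) (𝓝[<] (ν * T)) (𝓝 Λ₀) :=
    tendsto_adaptedFrequency_viscosity hlim hν
  have h3 : Module.finrank ℝ (EuclideanSpace ℝ (Fin 3)) = 3 := finrank_euclideanSpace_fin
  have h3' : ((Module.finrank ℝ (EuclideanSpace ℝ (Fin 3)) : ℕ) : ℝ) = 3 := by rw [h3]; norm_num
  -- Gaussian bounds after the viscosity normalisation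
  have hGbb : ∀ s ∈ Ico (ν * a) (ν * T), ∀ y,
      (c₁ * ν ^ ((3:ℝ) / 2)) * (ν * T - s) ^ (-(3:ℝ) / 2) *
          Real.exp (-(‖y - x₀‖ ^ 2) / ((c₂ / ν) * (ν * T - s))) ≤ Gb s y ∧
        Gb s y ≤ (C₁ * ν ^ ((3:ℝ) / 2)) * (ν * T - s) ^ (-(3:ℝ) / 2) *
          Real.exp (-(‖y - x₀‖ ^ 2) / ((C₂ / ν) * (ν * T - s))) := by
    intro s hs y
    have hs' : 0 + ν⁻¹ * s ∈ Ico t₀ T := by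
      refine ⟨?_, ?_⟩
      · have : ν * t₀ ≤ s := le_trans (mul_le_mul_of_nonneg_left ht₀a hν.le) hs.1
        rw [zero_add, le_inv_mul_iff₀' hν]; linarith
      · rw [zero_add, inv_mul_lt_iff₀' hν]; linarith [hs.2]
    have h := gaussian_bounds_viscosity (E := EuclideanSpace ℝ (Fin 3)) (G := G) (T := T) (x₀ := x₀)
      (c₁ := c₁) (c₂ := c₂) (C₁ := C₁) (C₂ := C₂) hν hs.2.le y (by
        rw [h3']
        exact hGb _ hs' y)
    rw [h3'] at h
    exact h
  -- the data
  set C₀ : ℝ := Cp / Real.sqrt ν with hC₀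
  set A : ℕ → ℝ := fun k => (ν * a - ν * T) / c k ^ 2 with hA
  set w : ℕ → ℝ → EuclideanSpace ℝ (Fin 3) → EuclideanSpace ℝ (Fin 3) :=
    fun k => c k • stPull (c k ^ 2) (c k) (ν * T) x₀ ub with hw
  set pw : ℕ → ℝ → EuclideanSpace ℝ (Fin 3) → ℝ :=
    fun k => c k ^ 2 • stPull (c k ^ 2) (c k) (ν * T) x₀ pb with hpw
  set g : ℕ → ℝ → EuclideanSpace ℝ (Fin 3) → ℝ :=
    fun k => (c k ^ 3) • stPull (c k ^ 2) (c k) (ν * T) x₀ Gb with hg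
  refine ⟨C₀, A, w, pw, g, rfl, ?_, tendsto_window_atBot hν haT hc hc0, ?_, ?_, ?_, ?_, ?_, ?_, ?_⟩
  · -- `0 ≤ C₀`
    exact div_nonneg (le_max_right _ _) (Real.sqrt_nonneg _)
  · -- `A k < 0`
    intro k
    exact div_neg_of_neg_of_pos (by nlinarith) (pow_pos (hc k) 2)
  · -- classical on the windows
    intro k
    exact isClassicalNSSolutionOn_zoom_Ico hclb (hc k) x₀
  · -- Type I
    intro k t ht x
    exact typeI_bound_zoom hIb (hc k) x₀ t ht x
  · -- Oseen-mild between window times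
    intro k s t hs hst ht x
    refine oseen_smul_stPull (hc k) (ν * T) x₀ hst (fun X => ?_) x
    have h1 : ν * a < ν * T + c k ^ 2 * s := by
      have hck : 0 < c k ^ 2 := pow_pos (hc k) 2
      have := (div_lt_iff₀ hck).1 hs
      linarith
    have h2 : ν * T + c k ^ 2 * t < ν * T := by
      have : c k ^ 2 * t < 0 := mul_neg_of_pos_of_neg (pow_pos (hc k) 2) ht
      linarith
    have h12 : ν * T + c k ^ 2 * s < ν * T + c k ^ 2 * t := by
      have := mul_lt_mul_of_pos_left hst (pow_pos (hc k) 2)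
      linarith
    exact oseenMild_viscosity_of_typeI_window hν hcl hLH ha0 hIp h1 h12 h2 X
  · -- adapted kernels
    intro k
    have h := isAdaptedBackwardKernel_zoom_Ico hKb (hc k)
    rw [h3] at h
    exact h
  · -- Gaussian bounds, same constants for all `k`
    intro k t ht y
    have ht' : ν * T + c k ^ 2 * t ∈ Ico (ν * a) (ν * T) := by
      refine ⟨?_, ?_⟩
      · have hck : 0 < c k ^ 2 := pow_pos (hc k) 2
        have := (div_le_iff₀ hck).1 ht.1
        linarith
      · have : c k ^ 2 * t < 0 := mul_neg_of_pos_of_neg (pow_pos (hc k) 2) ht.2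
        linarith
    have h := gaussian_bounds_zoom (E := EuclideanSpace ℝ (Fin 3)) (G := Gb) (T := ν * T) (x₀ := x₀)
      (c₁ := c₁ * ν ^ ((3:ℝ) / 2)) (c₂ := c₂ / ν) (C₁ := C₁ * ν ^ ((3:ℝ) / 2)) (C₂ := C₂ / ν)
      (hc k) ht.2.le y (by
        rw [h3']
        have e1 : ν * T - (ν * T + c k ^ 2 * t) = ν * T - (ν * T + c k ^ 2 * t) := rfl
        have hb := hGbb _ ht' (x₀ + c k • y)
        exact hb)
    rw [h3', h3] at h
    exact h
  · -- frequencies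
    intro τ hτ
    exact tendsto_adaptedFrequency_zoom_seq hlimb hc hc0 hτ

end Summit.NavierStokesRegularity.NavierStokesRegularity.Theorems

end
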